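import Summits.Ventures.Crystal3D.Theorems.StickyWulffConstantTextureBuildTentZoneCells
import Summits.Ventures.Crystal3D.Theorems.StickyWulffConstantTextureBuildCutLevel
import HarnessLib

/-!
# TB-energy blueprint: THE PIECES A.E. COVER the prisms, the cores and the solid free zone (material lemmas off one null set)
# (lane T, crux `TextureLiminfV5`, stmt-Ventures-23912; blueprint TexShadowTB; serves the mass line (…MassZone) and the LP1 engine (…ExposedFar))

HONEST FRAMING. Venture `Summits/Ventures/Crystal3D` (cell `crystal3d-full`), route `route-Ventures-StickyWulffConstant`, helper `--supports` the
law-v5 crux `TextureLiminfV5` (stmt-Ventures-23912).  Bookkeeping over the labelled cells of a texture input (standard axioms; no mesh constructed; F-C1 not moved).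

* `TexInput.pieceSet`, `massNull` (null: the a.e.-cover defect of `refineCells`, `{SolidAt} ∖ G_f` per grain, the layer planes, `closure P ∖ P` for `P ⊆ 𝓗`),
  `volume_massNull`; `exists_cell_of_mem`, `mem_polytope_of_mem_closure`;
* `mem_pieceSet_of_prism / _of_core / _of_solid / _of_counted` — material off `massNull` lies in the pieces.
-/

noncomputable section

open scoped BigOperators InnerProductSpace ENNReal
open MeasureTheory Set

namespace Summit.Ventures.Crystal3D.Cruxes.TextureLiminf.TexShadow

open Summit.Ventures.Crystal3D Summit.Ventures.Crystal3D.Theorems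
open Summit.Ventures.Crystal3D.TentCertificate (isOpen_laySlab mem_laySlab_iff)
open Literature.MathematicalPhysics.StatisticalMechanics (IsHaggSeq)

namespace TexInput

section generic

variable {C R₀ : ℝ} {N : ℕ} {x : Fin N → E3} {rc : RiseredCover C R₀ N x} {δ : ℝ} {μ : Mesh₅ rc δ} (I : TexInput rc μ)

/-! ### The pieces a.e. cover the prisms, the cores and the solid free zone -/

/-- the union of the pieces -/
def pieceSet : Set E3 := ⋃ i, polytope (I.cells.Hp i)

/-- A point of a LABELLED cell lies in the pieces. -/
theorem mem_pieceSet_of_isSome {j : Fin I.cells.k} (h : (I.cells.lab j).isSome = true) {z : E3} (hz : z ∈ I.cells.cell j) : z ∈ I.pieceSet := by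
  obtain ⟨i, hi⟩ := I.cells.exists_idx_eq h
  refine mem_iUnion.2 ⟨i, ?_⟩
  show z ∈ polytope (signedH I.𝓗 (I.cells.T (I.cells.idx i)))
  rw [hi]; exact hz

/-- the exceptional null set of the covering argument -/
def massNull : Set E3 :=
  ((⋃ G ∈ I.𝒢, polytope G) \ ⋃ j, I.cells.cell j) ∪
  (⋃ f : Fin rc.ng, ({y : E3 | ∀ b ∈ stacking (rc.tent f).L (rc.tent f).s (rc.tent f).σ, dist y b ≤ Real.sqrt 2 → b ∈ (rc.tent f).Xh} \ (I.ct f).G)) ∪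
  (⋃ f : Fin rc.ng, ⋃ i : ℤ, {y : E3 | ⟪(rc.tent f).L e₃, y⟫_ℝ = (i : ℝ) * TentCertificate.hB + ⟪(rc.tent f).L e₃, (rc.tent f).s⟫_ℝ}) ∪
  (⋃ G ∈ I.𝓗.powerset, (closure (polytope G) \ polytope G))

/-- The exceptional set is null. -/
theorem volume_massNull : volume I.massNull = 0 := by
  unfold massNull
  refine measure_union_null (measure_union_null (measure_union_null ?_ ?_) ?_) ?_
  · exact (ae_eq_set.1 (refineCells_ae_cover I.𝓗 I.𝓗_unit I.𝒢 I.𝒢_subset_𝓗 I.𝒢_bounded I.n I.lab₀)).1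
  · exact measure_iUnion_null fun f => (I.ct f).hmass
  · exact measure_iUnion_null fun f => volume_layerPlanes_eq_zero _ _
  · refine (measure_biUnion_null_iff (I.𝓗.powerset.finite_toSet.countable)).2 fun G hG => ?_
    have hG' : G ⊆ I.𝓗 := Finset.mem_powerset.1 hG
    have hne : ∀ p ∈ G, p.1 ≠ 0 := fun p hp h0 => by
      have := I.𝓗_unit p (hG' hp); rw [h0, norm_zero] at this; exact zero_ne_one this
    exact (ae_eq_set.1 (closure_polytope_ae_eq G hne)).1

/-- A point of `polytope G`, `G ∈ 𝒢`, off the exceptional set lies in a cell. -/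
theorem exists_cell_of_mem {G : Finset (E3 × ℝ)} (hG : G ∈ I.𝒢) {z : E3} (hz : z ∈ polytope G) (hzN : z ∉ I.massNull) :
    ∃ j, z ∈ I.cells.cell j := by
  by_contra h
  exact hzN (Or.inl (Or.inl (Or.inl ⟨mem_iUnion₂.2 ⟨G, hG, hz⟩, fun hh => by obtain ⟨j, hj⟩ := mem_iUnion.1 hh; exact h ⟨j, hj⟩⟩)))

/-- A point of the closure of `polytope G`, `G ⊆ 𝓗`, off the exceptional set lies in `polytope G`. -/
theorem mem_polytope_of_mem_closure {G : Finset (E3 × ℝ)} (hG : G ⊆ I.𝓗) {z : E3} (hz : z ∈ closure (polytope G)) (hzN : z ∉ I.massNull) :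
    z ∈ polytope G := by
  by_contra h
  exact hzN (Or.inr (mem_iUnion₂.2 ⟨G, Finset.mem_powerset.2 hG, hz, h⟩))

/-- **Prisms are covered**: a point of the closure of a prism off the exceptional set lies in the pieces. -/
theorem mem_pieceSet_of_prism (k : Fin rc.nk) {z : E3} (hz : z ∈ closure (polytope (μ.HP k))) (hzN : z ∉ I.massNull) : z ∈ I.pieceSet := by
  have hzP : z ∈ polytope (μ.HP k) := I.mem_polytope_of_mem_closure (I.HP_subset_𝓗 k) hz hzN
  have hG : μ.HP k ∈ I.𝒢 := by
    simp only [𝒢, Finset.mem_union, Finset.mem_biUnion, Finset.mem_univ, true_and, Finset.mem_image]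
    exact Or.inl (Or.inl (Or.inl (Or.inr ⟨k, rfl⟩)))
  obtain ⟨j, hzj⟩ := I.exists_cell_of_mem hG hzP hzN
  exact I.mem_pieceSet_of_isSome
    (I.isSome_lab_of_subset j (I.HP_subset_𝓗 k) (Or.inr (Or.inl ⟨k, rfl⟩))
      (refineCells_subset_of_mem _ _ _ _ _ _ _ j (I.HP_subset_𝓗 k) hzj hzP)) hzj

/-- **Cores are covered**: a point of the closure of the core off the exceptional set lies in the pieces. -/
theorem mem_pieceSet_of_core (f : Fin rc.ng) {z : E3} (hz : z ∈ closure (⋃ j, polytope (μ.HC f j))) (hzN : z ∉ I.massNull) : z ∈ I.pieceSet := by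
  rw [closure_iUnion_of_finite (ι := Fin (μ.nC f)) (fun j => polytope (μ.HC f j)), mem_iUnion] at hz
  obtain ⟨jc, hzc⟩ := hz
  have hzP : z ∈ polytope (μ.HC f jc) := I.mem_polytope_of_mem_closure (I.HC_subset_𝓗 f jc) hzc hzN
  have hG : μ.HC f jc ∈ I.𝒢 := by
    simp only [𝒢, Finset.mem_union, Finset.mem_biUnion, Finset.mem_univ, true_and, Finset.mem_image]
    exact Or.inl (Or.inl (Or.inl (Or.inl (Or.inr ⟨f, jc, rfl⟩))))
  obtain ⟨j, hzj⟩ := I.exists_cell_of_mem hG hzP hzN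
  exact I.mem_pieceSet_of_isSome
    (I.isSome_lab_of_subset j (I.HC_subset_𝓗 f jc) (Or.inl ⟨f, jc, rfl⟩)
      (refineCells_subset_of_mem _ _ _ _ _ _ _ j (I.HC_subset_𝓗 f jc) hzj hzP)) hzj

/-- **The solid free zone is covered**: an `f`-solid point of `U_f` off the exceptional set lies in the pieces. -/
theorem mem_pieceSet_of_solid (f : Fin rc.ng) {z : E3} (hzU : z ∈ (rc.tent f).U) (hsol : rc.SolidAt f z) (hzN : z ∉ I.massNull) : z ∈ I.pieceSet := by
  -- a.e. in the tent solid
  have hzG : z ∈ (I.ct f).G := by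
    by_contra h
    exact hzN (Or.inl (Or.inl (Or.inr (mem_iUnion.2 ⟨f, hsol, h⟩))))
  -- off the layer planes: in a slab of the window
  have hzp : z ∉ ⋃ i : ℤ, {y : E3 | ⟪(rc.tent f).L e₃, y⟫_ℝ = (i : ℝ) * TentCertificate.hB + ⟪(rc.tent f).L e₃, (rc.tent f).s⟫_ℝ} :=
    fun h => hzN (Or.inl (Or.inr (mem_iUnion.2 ⟨f, h⟩)))
  obtain ⟨i, hzi⟩ := exists_mem_laySlab_of_not_mem_planes _ _ hzp
  have hzD : z ∈ ⋃ j', polytope (μ.HD f j') := by have := hzU; rw [μ.hU f] at this; exact this.1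
  have hi : i ∈ I.slabWindow f := by
    rw [mem_slabWindow_iff]
    refine ⟨z, hzi, ?_⟩
    obtain ⟨j', hj'⟩ := mem_iUnion.1 hzD
    simp only [bigSet, mem_union, mem_iUnion]
    exact Or.inl (Or.inl (Or.inl (Or.inl ⟨f, j', hj'⟩)))
  -- in a cell
  obtain ⟨G, hG, hzG'⟩ := mem_iUnion₂.1 (I.G_subset_iUnion_𝒢 f hzG)
  obtain ⟨j, hzj⟩ := I.exists_cell_of_mem hG hzG' hzN
  -- the zone of class `(f, i)`
  have key := fun {z : E3} => I.mem_pieces_of_mem_cell (c := I.enc ⟨f, ⟨i, hi⟩⟩) (z := z) (j := j)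
  have hc : I.enc.symm (I.enc ⟨f, ⟨i, hi⟩⟩) = ⟨f, ⟨i, hi⟩⟩ := Equiv.symm_apply_apply _ _
  unfold zone at key
  rw [hc] at key
  exact key hzG ⟨hzU, hzi⟩ hzj

/-- **The counted region is covered**: territory-or-deep-prism points near a counted ball, off the exceptional set, lie in the pieces. -/
theorem mem_pieceSet_of_counted (f : Fin rc.ng) {a z : E3}
    (hcase : (a ∈ rc.S f ∧ ∀ b ∈ rc.S f, dist a b ≤ 2 * Real.sqrt 2 → b ∈ (rc.tent f).Xh ∧ b ∈ rc.X') ∨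
      (Disjoint (Metric.closedBall a (Real.sqrt 2)) (rc.tent f).U ∧ rc.LocPerfect a))
    (hza : z ∈ Metric.closedBall a (Real.sqrt 2))
    (hz : z ∈ (⋃ j, polytope (μ.HD f j)) ∪
        (⋃ k ∈ (Finset.univ.filter fun k => μ.fk k = f), (closure (polytope (μ.HP k)) ∩ {z | rc.height k z ≤ -1})) ∪
        (⋃ k ∈ (Finset.univ.filter fun k => μ.gk k = f), (closure (polytope (μ.HP k)) ∩ {z | (rc.cell k).h + 1 ≤ rc.height k z})))
    (hzN : z ∉ I.massNull) : z ∈ I.pieceSet := by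
  rcases hz with (hzD | hzP) | hzP
  · by_cases hzU : z ∈ (rc.tent f).U
    · rcases hcase with ⟨_, hreal⟩ | ⟨hdisj, _⟩
      · refine I.mem_pieceSet_of_solid f hzU (fun b hb hzb => (hreal b hb ?_).1) hzN
        calc dist a b ≤ dist a z + dist z b := dist_triangle _ _ _
          _ ≤ Real.sqrt 2 + Real.sqrt 2 := by
              have : dist a z ≤ Real.sqrt 2 := by rw [dist_comm]; exact Metric.mem_closedBall.1 hza
              linarith
          _ = 2 * Real.sqrt 2 := by ring
      · exact absurd hzU (Set.disjoint_left.1 hdisj hza)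
    · have hzc : z ∈ closure (⋃ j, polytope (μ.HC f j)) := by
        by_contra h
        exact hzU (by rw [μ.hU f]; exact ⟨hzD, h⟩)
      exact I.mem_pieceSet_of_core f hzc hzN
  · obtain ⟨k, -, hzk⟩ := mem_iUnion₂.1 hzP
    exact I.mem_pieceSet_of_prism k hzk.1 hzN
  · obtain ⟨k, -, hzk⟩ := mem_iUnion₂.1 hzP
    exact I.mem_pieceSet_of_prism k hzk.1 hzN

end generic

end TexInput

end Summit.Ventures.Crystal3D.Cruxes.TextureLiminf.TexShadow

end
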